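import Mathlib
import Literature.NumberTheory.Transcendental.KZProduct
import Literature.NumberTheory.Transcendental.KZProductIdeal
import Literature.NumberTheory.Transcendental.KZDominatedFamilyRelations
import Literature.NumberTheory.Transcendental.KZSubcalculusInvariants
import Summits.KontsevichZagierPeriods.KontsevichZagierPeriods.Theorems.SoloInformedPiDisc
import Summits.KontsevichZagierPeriods.KontsevichZagierPeriods.Theorems.SoloInformedCalabiMap
import Summits.KontsevichZagierPeriods.KontsevichZagierPeriods.Theorems.SoloInformedZetaTwoReps
import HarnessLib
import HarnessLib.Audit

/-!
# SoloInformed — `ζ(2) = π²/6` inside the Kontsevich–Zagier calculus, II: the chain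

Kontsevich–Zagier [2001, §1.2] list `ζ(2) = π²/6` among the "accessible identities" provable by
the three rules. This file makes that a KERNEL statement about the typed calculus
`KZ.relations` of the tree:

  `soloInformed_six_zetaTwo_sub_pi_mul_pi_mem_relations :
     6 • [(0,1)², 1/(1−xy)] − [D̄]·[D̄] ∈ KZ.relations`.

The chain (all maps defined over `ℚ`): `[D̄] ∼ 4·[[0,1], 1/(1+t²)]` (`SoloInformedPiDisc`), so
`[D̄]·[D̄] ∼ 16 · [[0,1]², 1/((1+a²)(1+b²))]` (product rule of the ideal of relations); restrict
to the open square (null boundary), split along the null curve `a + b + ab = 1` into the Calabi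
triangle `T` and the co-triangle `T'` (rule 1a); `T' → T` by the Möbius involution
`σ = ((1−a)/(1+a), (1−b)/(1+b))` (rule 2; the weight `da db/((1+a²)(1+b²))` is `σ`-invariant);
`T → (0,1)²` by the rational Calabi map `Ψ = (S(a)/C(b), S(b)/C(a))` (rule 2), whose Jacobian
turns `4/((1+a²)(1+b²))` into `1/(1 − x²y²)`; finally `3·[Z] ∼ 4·[J]` (`SoloInformedZetaTwoReps`).

Consequence (`soloInformed_kzp_instance_zetaTwo`): the pair `[(0,1)², 6/(1−xy)]` (dimension 2)
and `[D̄ × D̄, 1]` (dimension 4) — rational data, equal values `π²`, and NO common algebraic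
fibration — is `KZ.Equivalent`, an instance of the conclusion of `KZPeriodConjecture` produced
by an explicit chain. In the residency's census (paper §8) this is the positive counterpart of the
torus/box pair `[T, dx dy/xy] / [B, dx dy dz]`, whose equivalence is equivalent to the open
transcendence statement `π² ∉ ℚ·log 2·log 3` ((C4EW)(2,3), below Four Exponentials by
`SoloInformedFourExp`): the wall there is the VALUE, not the syntax of the calculus.

Residency `solo-KontsevichZagierPeriods-informed` (PLAN.md, session s17).
-/

noncomputable section

namespace Summit.KontsevichZagierPeriods.KontsevichZagierPeriods.Theorems

open Literature.NumberTheory.Transcendental Literature.NumberTheory.Transcendental.KZ MvPolynomial Set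
  MeasureTheory

/-! ### The moves, continued: the Calabi triangle -/

/-- **Step 4** (rule 2, the Calabi map): `[T, 4/((1+a²)(1+b²))] − [J] ∈ relations`. -/
theorem soloInformed_tri_sub_J_mem_relations :
    of soloInformedCalabiTriRep - of soloInformedJRep ∈ relations := by
  have hQ : ∀ j, ∀ u ∈ soloInformedCalabiSrc, (aeval u (soloInformedCalabiQ j) : ℝ) ≠ 0 := by
    intro j u hu
    have h := soloInformed_lt_one_of_mem_calabiSrc hu
    exact soloInformed_calabiQ_ne_zero h.1 hu.1.le h.2 hu.2.1.le j
  refine changeOfVariablesRel_subset_relations ⟨2, soloInformedCalabiTriRep, soloInformedJRep,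
    soloInformedCalabi, soloInformedRatJacCLM soloInformedCalabiP soloInformedCalabiQ,
    soloInformed_isSemialgebraicMapOn_ratMap isSemialgebraic_soloInformedCalabiSrc _ _ hQ,
    fun u hu => (soloInformed_hasFDerivAt_ratMap _ _ u fun j => hQ j u hu).hasFDerivWithinAt,
    soloInformed_calabi_injOn, soloInformed_calabi_image.symm, fun u hu => ?_, rfl⟩
  have hsq := soloInformed_calabi_mem_openSq hu
  have hD := soloInformed_one_sub_mul_sq_pos hsq
  have hlt := soloInformed_lt_one_of_mem_calabiSrc hu
  have ha : (1 : ℝ) - u 0 ^ 2 ≠ 0 := by nlinarith [hu.1, hlt.1]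
  have hb : (1 : ℝ) - u 1 ^ 2 ≠ 0 := by nlinarith [hu.2.1, hlt.2]
  show soloInformedP4Rep.integrand u = _
  rw [soloInformed_P4Rep_integrand, soloInformed_det_calabi u ha hb, soloInformedJRep_integrand,
    abs_of_pos (by positivity)]
  beta_reduce
  have hD' : (1 : ℝ) - soloInformedCalabi u 0 ^ 2 * soloInformedCalabi u 1 ^ 2 ≠ 0 := by
    rw [← mul_pow]; exact hD.ne'
  have hD'' : (1 : ℝ) - (soloInformedCalabi u 0 * soloInformedCalabi u 1) ^ 2 ≠ 0 := hD.ne'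
  field_simp

/-- **Step 5** (rule 2, the Möbius involution): `[T', w] − [T, w] ∈ relations`. -/
theorem soloInformed_co_sub_tri_mem_relations :
    of soloInformedCalabiCoRep - of soloInformedCalabiTriRep ∈ relations := by
  have hQ : ∀ j, ∀ u ∈ soloInformedCalabiCo, (aeval u (soloInformedMoebQ j) : ℝ) ≠ 0 :=
    fun j u hu => soloInformed_moebQ_ne_zero hu.1.1.le hu.2.1.1.le j
  refine changeOfVariablesRel_subset_relations ⟨2, soloInformedCalabiCoRep, soloInformedCalabiTriRep,
    soloInformedMoeb, soloInformedRatJacCLM soloInformedMoebP soloInformedMoebQ,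
    soloInformed_isSemialgebraicMapOn_ratMap isSemialgebraic_soloInformedCalabiCo _ _ hQ,
    fun u hu => (soloInformed_hasFDerivAt_ratMap _ _ u fun j => hQ j u hu).hasFDerivWithinAt,
    soloInformed_moeb_injOn, soloInformed_moeb_image.symm, fun u hu => ?_, rfl⟩
  obtain ⟨⟨h0, -⟩, ⟨h1, -⟩, -⟩ := hu
  have ha : (1 : ℝ) + u 0 ≠ 0 := by linarith
  have hb : (1 : ℝ) + u 1 ≠ 0 := by linarith
  show soloInformedP4Rep.integrand u = soloInformedP4Rep.integrand (soloInformedMoeb u) * _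
  rw [soloInformed_P4Rep_integrand, soloInformed_P4Rep_integrand, soloInformed_det_moeb u ha hb,
    abs_of_pos (by positivity), soloInformedMoeb_apply_zero, soloInformedMoeb_apply_one]
  field_simp
  ring

/-- **Step 6** (rule 1a): `[T ∪ T', w] − [T, w] − [T', w] ∈ relations` (disjoint pieces). -/
theorem soloInformed_sq4'_sub_tri_sub_co_mem_relations :
    of soloInformedSq4Rep' - of soloInformedCalabiTriRep - of soloInformedCalabiCoRep ∈ relations := by
  refine domainAddRel_subset_relations ⟨2, soloInformedSq4Rep', soloInformedCalabiTriRep,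
    soloInformedCalabiCoRep, rfl, ?_, fun _ _ => rfl, fun _ _ => rfl, rfl⟩
  have : soloInformedCalabiTriRep.domain ∩ soloInformedCalabiCoRep.domain = ∅ := by
    ext u
    simp only [mem_inter_iff, mem_empty_iff_false, iff_false, not_and]
    intro h1 h2
    have a := h1.2.2
    have b := h2.2.2
    exact absurd (a.trans b) (lt_irrefl _)
  rw [this, measure_empty]

/-- **Step 7** (rule 1a, null curve): `[(0,1)², w] − [T ∪ T', w] ∈ relations`. -/
theorem soloInformed_sq4_sub_sq4'_mem_relations :
    of soloInformedSq4Rep - of soloInformedSq4Rep' ∈ relations :=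
  soloInformedSq4Rep.of_sub_of_restrict_mem_relations
    (isSemialgebraic_soloInformedCalabiSrc.union isSemialgebraic_soloInformedCalabiCo)
    (union_subset soloInformedCalabiSrc_subset_openSq soloInformedCalabiCo_subset_openSq)
    soloInformed_volume_openSq_diff

/-- **Step 8** (rule 1a, null boundary): `[[0,1]², w] − [(0,1)², w] ∈ relations`. -/
theorem soloInformed_P4_sub_sq4_mem_relations :
    of soloInformedP4Rep - of soloInformedSq4Rep ∈ relations := by
  refine soloInformedP4Rep.of_sub_of_restrict_mem_relations isSemialgebraic_soloInformedOpenSq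
    soloInformedOpenSq_subset_P4 ?_
  have hax : ∀ (i : Fin 2) (c : ℝ), volume {u : Fin 2 → ℝ | u i = c} = 0 := fun i c => by
    rw [volume_pi]; exact Measure.pi_hyperplane _ _ _
  refine measure_mono_null (fun u hu => ?_)
    (measure_union_null (measure_union_null (hax 0 0) (hax 0 1))
      (measure_union_null (hax 1 0) (hax 1 1)))
  obtain ⟨hP, hn⟩ := hu
  rw [soloInformed_mem_P4Rep_domain] at hP
  rw [soloInformed_mem_openSq] at hn
  simp only [mem_union, mem_setOf_eq]
  by_contra hc
  simp only [not_or] at hc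
  obtain ⟨⟨h00, h01⟩, h10, h11⟩ := hc
  exact hn ⟨⟨lt_of_le_of_ne hP.1.1 (Ne.symm h00), lt_of_le_of_ne hP.1.2 h01⟩,
    lt_of_le_of_ne hP.2.1 (Ne.symm h10), lt_of_le_of_ne hP.2.2 h11⟩

/-- **Step 9** (rule 1b): `[P₄] − 4·([A] * [A]) ∈ relations`, `A = [[0,1], 1/(1+t²)]`. -/
theorem soloInformed_P4_sub_four_prod_mem_relations :
    of soloInformedP4Rep - 4 • (of soloInformedArctanRep * of soloInformedArctanRep) ∈ relations := by
  rw [of_mul_of]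
  exact IntegralRep.of_constMul_nat_sub_nsmul_mem_relations _ 4

/-! ### Euler's identity in the calculus -/

/-- **`ζ(2) = π²/6` inside the Kontsevich–Zagier calculus**:
`6·[(0,1)², 1/(1−xy)] − [D̄]·[D̄] ∈ KZ.relations`, i.e. Beukers' integral for `6ζ(2)` and the
`4`-dimensional volume `[D̄ × D̄, 1] = π²` are connected by an explicit finite chain of the four
moves (integrand splitting, the squaring map, Calabi's rational change of variables
`(a,b) ↦ (S(a)/C(b), S(b)/C(a))` from the triangle `{a+b+ab<1}`, the Möbius involution, domain
additivity along a null curve, Fubini products and `π = 4∫₀¹dt/(1+t²)`).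
[Kontsevich–Zagier 2001, §1.2 ("accessible identity" `ζ(2) = π²/6`); Beukers–Calabi–Kolk 1993] -/
theorem soloInformed_six_zetaTwo_sub_pi_mul_pi_mem_relations :
    6 • of soloInformedZetaTwoRep - of piRep * of piRep ∈ relations := by
  have R1 := soloInformed_three_zeta_sub_four_J_mem_relations
  have R2 := soloInformed_tri_sub_J_mem_relations
  have R3 := soloInformed_co_sub_tri_mem_relations
  have R4 := soloInformed_sq4'_sub_tri_sub_co_mem_relations
  have R5 := soloInformed_sq4_sub_sq4'_mem_relations
  have R6 := soloInformed_P4_sub_sq4_mem_relations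
  have R7 := soloInformed_P4_sub_four_prod_mem_relations
  have R8 : of piRep * of piRep -
      16 • (of soloInformedArctanRep * of soloInformedArctanRep) ∈ relations := by
    have h := sub_mul_sub_mem_relations mul_mem_relations_left_holds mul_mem_relations_right_holds
      soloInformed_piRep_sub_four_nsmul_arctanRep_mem_relations
      soloInformed_piRep_sub_four_nsmul_arctanRep_mem_relations
    have e : (4 • of soloInformedArctanRep) * (4 • of soloInformedArctanRep) =
        16 • (of soloInformedArctanRep * of soloInformedArctanRep) := by
      rw [smul_mul_assoc, mul_smul_comm, smul_smul]; norm_num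
    rwa [e] at h
  have e : 6 • of soloInformedZetaTwoRep - of piRep * of piRep =
      2 • (3 • of soloInformedZetaTwoRep - 4 • of soloInformedJRep) -
        8 • (of soloInformedCalabiTriRep - of soloInformedJRep) -
        4 • (of soloInformedCalabiCoRep - of soloInformedCalabiTriRep) -
        4 • (of soloInformedSq4Rep' - of soloInformedCalabiTriRep - of soloInformedCalabiCoRep) -
        4 • (of soloInformedSq4Rep - of soloInformedSq4Rep') -
        4 • (of soloInformedP4Rep - of soloInformedSq4Rep) +
        4 • (of soloInformedP4Rep - 4 • (of soloInformedArctanRep * of soloInformedArctanRep)) -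
        (of piRep * of piRep - 16 • (of soloInformedArctanRep * of soloInformedArctanRep)) := by
    abel
  rw [e]
  refine relations.sub_mem (relations.add_mem ?_ (relations.nsmul_mem R7 4)) R8
  exact relations.sub_mem (relations.sub_mem (relations.sub_mem (relations.sub_mem
    (relations.sub_mem (relations.nsmul_mem R1 2) (relations.nsmul_mem R2 8))
    (relations.nsmul_mem R3 4)) (relations.nsmul_mem R4 4)) (relations.nsmul_mem R5 4))
    (relations.nsmul_mem R6 4)

/-! ### An instance of the conclusion of the period conjecture across fibration classes -/

/-- `[(0,1)², 6/(1−xy)]`. -/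
def soloInformedSixZetaTwoRep : IntegralRep 2 :=
  soloInformedZetaTwoRep.constMul ((6 : ℕ) : ℝ) (isAlgebraic_nat 6)

/-- `[D̄ × D̄, 1]` (dimension `4`). -/
def soloInformedPiSqRep : IntegralRep 4 := piRep.prod piRep

/-- `[(0,1)², 6/(1−xy)]` has rational data. -/
theorem soloInformed_sixZetaTwoRep_isRational : soloInformedSixZetaTwoRep.IsRational := by
  refine ⟨C 6, 1 - X 0 * X 1, fun z hz => ?_, fun z _ => ?_⟩
  · simpa using (soloInformed_one_sub_mul_pos hz).ne'
  · simp [soloInformedSixZetaTwoRep, div_eq_mul_one_div (6 : ℝ)]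

/-- `[D̄ × D̄, 1]` has rational data. -/
theorem soloInformed_piSqRep_isRational : soloInformedPiSqRep.IsRational := by
  refine ⟨1, 1, fun z _ => by simp, fun z _ => ?_⟩
  simp [soloInformedPiSqRep, IntegralRep.prod_integrand_eq, IntegralRep.prodFun_apply]

/-- `value [(0,1)², 6/(1−xy)] = π²`. -/
theorem soloInformed_sixZetaTwoRep_value : soloInformedSixZetaTwoRep.value = Real.pi ^ 2 := by
  rw [soloInformedSixZetaTwoRep, IntegralRep.value_constMul, soloInformed_zetaTwoRep_value]
  push_cast
  ring

/-- `value [D̄ × D̄, 1] = π²`. -/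
theorem soloInformed_piSqRep_value : soloInformedPiSqRep.value = Real.pi ^ 2 := by
  rw [soloInformedPiSqRep, IntegralRep.value_prod, piRep_value, sq]

/-- **An instance of `KZPeriodConjecture`'s conclusion for a pair with no common algebraic
fibration**: the rational-data representations `[(0,1)², 6/(1−xy)]` (dimension `2`) and
`[D̄ × D̄, 1]` (dimension `4`) have the same value `π²` AND are `KZ.Equivalent` — by the explicit
chain of `soloInformed_six_zetaTwo_sub_pi_mul_pi_mem_relations`, not by the conjecture. -/
theorem soloInformed_kzp_instance_zetaTwo :
    soloInformedSixZetaTwoRep.IsRational ∧ soloInformedPiSqRep.IsRational ∧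
      soloInformedSixZetaTwoRep.value = soloInformedPiSqRep.value ∧
      Equivalent soloInformedSixZetaTwoRep soloInformedPiSqRep := by
  refine ⟨soloInformed_sixZetaTwoRep_isRational, soloInformed_piSqRep_isRational,
    by rw [soloInformed_sixZetaTwoRep_value, soloInformed_piSqRep_value], ?_⟩
  have h6 : of soloInformedSixZetaTwoRep - 6 • of soloInformedZetaTwoRep ∈ relations :=
    IntegralRep.of_constMul_nat_sub_nsmul_mem_relations _ 6
  have h := soloInformed_six_zetaTwo_sub_pi_mul_pi_mem_relations
  show of soloInformedSixZetaTwoRep - of (piRep.prod piRep) ∈ relations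
  rw [← of_mul_of]
  have e : of soloInformedSixZetaTwoRep - of piRep * of piRep =
      (of soloInformedSixZetaTwoRep - 6 • of soloInformedZetaTwoRep) +
        (6 • of soloInformedZetaTwoRep - of piRep * of piRep) := by abel
  rw [e]
  exact relations.add_mem h6 h

end Summit.KontsevichZagierPeriods.KontsevichZagierPeriods.Theorems
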